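import Literature.Topology.CoveringSpaces.CoveringIdRigid
import Literature.Topology.CoveringSpaces.CoveringMonodromyStabilizer
import Literature.AnabelianGeometry.Anabelioids.BCatTwistedNaturalFamily
import HarnessLib

/-!
# Twisted natural families on the connected finite covers of `X` force the twist to be inner on
# `π̂₁(X, x₀)`: the junction «lifts of `σ` to the tower of covers ⇒ `σ_*` profinitely inner»

Topic `Literature/Topology/CoveringSpaces` (abc-iut cell, campaign-L R1.2, GAP row G-L4t14-R1; seat
abc-iut-w5-d144 gen 4, row «H1PRIME-HOLRS» junction (J)).  S. Mochizuki, *Topics in Absolute Anabelian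
Geometry III*, proof of Prop. 4.2 (i), kurims p.106 l.11–19, uses that an automorphism `σ` of a
hyperbolic `X` which lifts COMPATIBLY to all finite étale coverings of `X` acts on the fundamental group
by an inner automorphism (then slimness / «`Aut(X) → Out(π̂₁)`» kills it).  This file is the
topological junction between the categorical datum (a natural family of lifts of `σ` to the connected
finite covers) and the group-theoretic conclusion (abc-iut-L6-t18's
`exists_eq_conj_of_twisted_natural` on `B(π̂₁)`), for `X` path connected and strongly locally
contractible with basepoint `x₀`:

* `CovFin.exists_eq_conj_of_twisted_fibre_family` — if `θ` is an endomorphism of `π₁(X, x₀)` and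
  `μ_E : p_E⁻¹(x₀) → p_E⁻¹(x₀)` (for all finite covers `E`, used only on the connected ones) satisfies
  `μ_E (θ(γ) · e) = γ · μ_E e` and commutes with the fibre maps of all morphisms between connected
  finite covers, then `θ̂` is INNER on `π̂₁(X, x₀)`: `ι(θ γ) = n⁻¹ ι(γ) n`.  (Transport along the
  lineage's `CovFin.equivBCat x₀ : Cov^fin(X) ≌ B(π̂₁)` to the full subcategory of `B(π̂₁)` on objects
  whose associated cover is connected — it contains the coset objects `π̂₁/K` —, extend the twisted
  equivariance from `π₁` to `π̂₁` by density, and apply abc-iut-L6-t18's theorem.)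
* `CovFin.monodromy_map_of_over` — a continuous `b : E → E` over a continuous `σ : X → X`
  (`p ∘ b = σ ∘ p`) carries monodromy along `λ` to monodromy along `σ ∘ λ` (uniqueness of lifts).
* `CovFin.map_twist_eq` — for a homeomorphism `σ` and a path `δ : x₀ ⇝ σ x₀`, the automorphism
  `θ_{σ,δ} = (σ_*)⁻¹ ∘ Ad(δ)` of `π₁(X, x₀)` (the tree's `Homeomorph.fundamentalGroupMulEquiv`,
  Mathlib's `fundamentalGroupMulEquivOfPath`) satisfies `σ_* (θ γ) = δ⁻¹ · γ · δ`.
* `CovFin.exists_eq_conj_of_twisted_cover_family_of_map`, `CovFin.exists_eq_conj_of_twisted_cover_family`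
  — **if every connected finite cover `E → X` carries a continuous self-map `b_E` over `σ`, naturally
  in `E`, then `θ_{σ,δ}` is inner on `π̂₁(X, x₀)`** (the fibre maps `e ↦ δ⁻¹ · b_E e` form a
  `θ`-twisted natural family).  Contrapositive = the per-object criterion of [AbsTopIII] Prop. 4.2 (i):
  an automorphism whose outer action on `π̂₁(X^top)` is non-trivial admits no natural family of lifts.

Everything is proved; no definitions, no instances, no named facts; nothing here bears on
[IUTchIII] Cor. 3.12.

## References

* S. Mochizuki, *Topics in Absolute Anabelian Geometry III*, kurims ms, §0 p.27, Prop 4.2 (i) / Lemma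
  4.3 p.106. [MochizukiAbsTopIII2015]
* S. Mochizuki, *Semi-graphs of anabelioids*, Publ. RIMS 42 (2006), §0 p.6. [MochizukiSemiAnbd2006]
* A. Hatcher, *Algebraic Topology*, CUP 2002, §1.1 Prop. 1.5 (change of basepoint), §1.3 Prop. 1.34
  (unique lifting). [HatcherAT2002]
-/

noncomputable section

open CategoryTheory Topology
open Literature.AlgebraicGeometry.Frobenioids (BCat)
open Literature.IUT.HodgeTheaters (profiniteCompletion toCompletion)
open Literature.GroupTheory Literature.GroupTheory.FiniteActionCompletion
open Literature.AnabelianGeometry.Anabelioids (exists_eq_conj_of_twisted_natural)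
open scoped FintypeCatDiscrete Pointwise

universe u

namespace Literature.Topology.CoveringSpaces.CovFin

variable {X : Type u} [TopologicalSpace X] [PathConnectedSpace X] [StronglyLocallyContractibleSpace X]
  (x₀ : X)

/-- **A `θ`-twisted natural family of fibre bijections on the connected finite covers forces `θ̂` to
be inner.**  Let `θ` be an endomorphism of `π₁(X, x₀)` and suppose given, for every finite covering
space `E` of `X`, a self-map `μ_E` of the fibre `p_E⁻¹(x₀)` such that, whenever `E` is connected,
`μ_E (θ(γ) · e) = γ · μ_E e` (monodromy action), and the `μ_E` commute
with the fibre maps of all morphisms between connected finite covers.  Then the endomorphism `θ̂` of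
the profinite completion `π̂₁(X, x₀)` induced by `θ` is INNER: `θ̂ = n⁻¹ (·) n` for some `n ∈ π̂₁`; in
particular `ι(θ γ) = n⁻¹ ι(γ) n` for all `γ ∈ π₁(X, x₀)`.  (Transport the family along
`Cov^fin(X) ≌ B(π̂₁)` to the full subcategory of `B(π̂₁)` on objects with connected associated cover
— it contains the coset objects `π̂₁/K` — extend the twisted equivariance from `π₁` to `π̂₁` by
density, and apply abc-iut-L6-t18's `exists_eq_conj_of_twisted_natural`.)
[cite: MochizukiSemiAnbd2006, Section 0 p.6] [cite: MochizukiAbsTopIII2015, Proposition 4.2 (i) p.106] -/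
theorem exists_eq_conj_of_twisted_fibre_family
    (θ : FundamentalGroup X x₀ →* FundamentalGroup X x₀)
    (μ : ∀ E : CovFin X, (E.proj ⁻¹' {x₀}) → (E.proj ⁻¹' {x₀}))
    (hμeq : ∀ (E : CovFin X), ConnectedSpace E.obj.left →
      ∀ (γ : FundamentalGroup X x₀) (e : E.proj ⁻¹' {x₀}),
        μ E (E.isCoveringMap_proj.monodromy (θ γ) e) = E.isCoveringMap_proj.monodromy γ (μ E e))
    (hμnat : ∀ {E E' : CovFin X}, ConnectedSpace E.obj.left → ConnectedSpace E'.obj.left →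
      ∀ (k : E ⟶ E') (e : E.proj ⁻¹' {x₀}),
        μ E' (((fibreFunctor x₀).map k).hom e) = ((fibreFunctor x₀).map k).hom (μ E e)) :
    ∃ n : profiniteCompletion (FundamentalGroup X x₀),
      ∀ γ : FundamentalGroup X x₀,
        toCompletion _ (θ γ) = n⁻¹ * toCompletion _ γ * n := by
  classical
  let G := FundamentalGroup X x₀
  -- the completed endomorphism `θ̂`
  let θhat : profiniteCompletion G ⟶ profiniteCompletion G :=
    ProfiniteGrp.ProfiniteCompletion.lift
      (GrpCat.ofHom θ ≫ ProfiniteGrp.ProfiniteCompletion.eta (GrpCat.of G))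
  have hθhat : ∀ γ : G, θhat.hom (toCompletion G γ) = toCompletion G (θ γ) := fun γ => by
    have h := ProfiniteGrp.ProfiniteCompletion.lift_eta
      (GrpCat.ofHom θ ≫ ProfiniteGrp.ProfiniteCompletion.eta (GrpCat.of G))
    exact congrArg (fun f => (f : G →* _) γ) (congrArg GrpCat.Hom.hom h)
  -- the equivalence `Cov^fin(X) ≌ B(π̂₁)` and the property «associated cover connected»
  let e := equivBCat (X := X) x₀
  let P : ObjectProperty (BCat (profiniteCompletion G)) := fun U => ConnectedSpace (e.inverse.obj U).obj.left
  -- notation for the counit at `U`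
  let c : ∀ U : BCat (profiniteCompletion G), (e.functor.obj (e.inverse.obj U)).obj.V ⟶ U.obj.V :=
    fun U => (e.counitIso.app U).hom.hom.hom
  let c' : ∀ U : BCat (profiniteCompletion G), U.obj.V ⟶ (e.functor.obj (e.inverse.obj U)).obj.V :=
    fun U => (e.counitIso.app U).inv.hom.hom
  have hcc' : ∀ U x, (c U).hom ((c' U).hom x) = x := fun U x => by
    have h := congrArg (fun k => k.hom.hom.hom x) (e.counitIso.app U).inv_hom_id
    exact h
  have hc'c : ∀ U y, (c' U).hom ((c U).hom y) = y := fun U y => by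
    have h := congrArg (fun k => k.hom.hom.hom y) (e.counitIso.app U).hom_inv_id
    exact h
  have hceq : ∀ U (g : profiniteCompletion G) (y : (e.functor.obj (e.inverse.obj U)).obj.V),
      (c U).hom (((e.functor.obj (e.inverse.obj U)).obj.ρ g).hom y) = (U.obj.ρ g).hom ((c U).hom y) :=
    fun U g y => by
      have h := (e.counitIso.app U).hom.hom.comm g
      exact congrFun (congrArg (fun k => k.hom) h) y
  have hc'eq : ∀ U (g : profiniteCompletion G) (x : U.obj.V),
      (c' U).hom ((U.obj.ρ g).hom x) = ((e.functor.obj (e.inverse.obj U)).obj.ρ g).hom ((c' U).hom x) :=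
    fun U g x => by
      have h := (e.counitIso.app U).inv.hom.comm g
      exact congrFun (congrArg (fun k => k.hom) h) x
  -- the action on the functor side is `completionSMul` of the monodromy action, extending it
  have hρ : ∀ (E : CovFin X) (g : profiniteCompletion G) (y : (E.proj ⁻¹' {x₀})),
      ((e.functor.obj E).obj.ρ g).hom y =
        letI := E.isCoveringMap_proj.fundamentalGroupMulAction x₀
        haveI : Finite (E.proj ⁻¹' {x₀}) := E.finite_fibre x₀
        completionSMul (G := G) (S := (E.proj ⁻¹' {x₀})) g y :=
    fun E g y => rfl
  have hρeta : ∀ (E : CovFin X) (γ : G) (y : (E.proj ⁻¹' {x₀})),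
      ((e.functor.obj E).obj.ρ (toCompletion G γ)).hom y = E.isCoveringMap_proj.monodromy γ y :=
    fun E γ y => by
      letI := E.isCoveringMap_proj.fundamentalGroupMulAction x₀
      haveI : Finite (E.proj ⁻¹' {x₀}) := E.finite_fibre x₀
      rw [hρ]
      exact completionSMul_eta (G := G) (S := (E.proj ⁻¹' {x₀})) γ y
  -- (hP) the coset objects `π̂₁/K` have connected associated cover
  have hP : ∀ (K : OpenNormalSubgroup (profiniteCompletion G))
      [Finite (profiniteCompletion G ⧸ K.toSubgroup)],
      P (Literature.AnabelianGeometry.Anabelioids.Induction.quotObj K.toSubgroup K.isOpen') := by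
    intro K _
    let U := Literature.AnabelianGeometry.Anabelioids.Induction.quotObj
      (G := profiniteCompletion G) K.toSubgroup K.isOpen'
    let E := e.inverse.obj U
    change ConnectedSpace E.obj.left
    letI := E.isCoveringMap_proj.fundamentalGroupMulAction x₀
    haveI : Finite (E.proj ⁻¹' {x₀}) := E.finite_fibre x₀
    -- the fibre is nonempty (it is in bijection with `π̂₁/K`)
    haveI : Nonempty (E.proj ⁻¹' {x₀}) := ⟨(c' U).hom ((1 : profiniteCompletion G) : _ ⧸ K.toSubgroup)⟩
    haveI : Nonempty E.obj.left := ⟨((Classical.arbitrary (E.proj ⁻¹' {x₀}) : _) : E.obj.left)⟩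
    -- the monodromy action is transitive
    have htrans : MulAction.IsPretransitive G (E.proj ⁻¹' {x₀}) := by
      refine ⟨fun y y' => ?_⟩
      obtain ⟨g, hg⟩ := (Literature.AnabelianGeometry.Anabelioids.nonempty_and_isPretransitive_quotObj
        (G := profiniteCompletion G) K.toSubgroup K.isOpen').2.exists_smul_eq
          ((c U).hom y) ((c U).hom y')
      change (U.obj.ρ g).hom ((c U).hom y) = (c U).hom y' at hg
      -- `g` acts on the fibre like some `γ ∈ π₁`
      obtain ⟨γ, hγ⟩ := exists_completionSMul_eq (G := G) (S := (E.proj ⁻¹' {x₀})) g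
      refine ⟨γ, ?_⟩
      have h1 : (c U).hom (((e.functor.obj E).obj.ρ g).hom y) = (c U).hom y' := by
        rw [hceq]; exact hg
      have h2 : ((e.functor.obj E).obj.ρ g).hom y = y' := by
        have := congrArg (fun z => (c' U).hom z) h1
        simpa only [hc'c] using this
      rw [hρ, hγ] at h2
      exact h2
    haveI : PathConnectedSpace E.obj.left :=
      (CoverMonodromy.pathConnectedSpace_iff_isPretransitive E.isCoveringMap_proj x₀).mpr htrans
    infer_instance
  -- the transported family on `P`-objects of `B(π̂₁)`
  let η : ∀ U : P.FullSubcategory, U.obj.obj.V → U.obj.obj.V :=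
    fun U x => (c U.obj).hom (μ (e.inverse.obj U.obj) ((c' U.obj).hom x))
  -- twisted equivariance, first on the fibre for all of `π̂₁` (density), then transported
  have hμhat : ∀ (E : CovFin X), ConnectedSpace E.obj.left →
      ∀ (g : profiniteCompletion G) (y : (E.proj ⁻¹' {x₀})),
        μ E (((e.functor.obj E).obj.ρ (θhat.hom g)).hom y) = ((e.functor.obj E).obj.ρ g).hom (μ E y) := by
    intro E hE g y
    letI := E.isCoveringMap_proj.fundamentalGroupMulAction x₀
    haveI : Finite (E.proj ⁻¹' {x₀}) := E.finite_fibre x₀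
    haveI : DiscreteTopology (E.proj ⁻¹' {x₀}) := (E.isCoveringMap_proj x₀).1
    letI : MulAction (profiniteCompletion G) (E.proj ⁻¹' {x₀}) :=
      completionMulAction (G := G) (S := (E.proj ⁻¹' {x₀}))
    have hsm : Continuous fun p : profiniteCompletion G × (E.proj ⁻¹' {x₀}) =>
        completionSMul (G := G) (S := (E.proj ⁻¹' {x₀})) p.1 p.2 :=
      (continuousSMul_completion (G := G) (S := (E.proj ⁻¹' {x₀}))).continuous_smul
    have h₁ : Continuous fun g : profiniteCompletion G =>
        μ E (completionSMul (G := G) (S := (E.proj ⁻¹' {x₀})) (θhat.hom g) y) :=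
      continuous_of_discreteTopology.comp
        (hsm.comp (θhat.hom.continuous_toFun.prodMk continuous_const))
    have h₂ : Continuous fun g : profiniteCompletion G =>
        completionSMul (G := G) (S := (E.proj ⁻¹' {x₀})) g (μ E y) :=
      hsm.comp (continuous_id.prodMk continuous_const)
    have heta : ∀ (γ : G) (s : (E.proj ⁻¹' {x₀})),
        completionSMul (G := G) (S := (E.proj ⁻¹' {x₀})) (toCompletion G γ) s =
          E.isCoveringMap_proj.monodromy γ s :=
      fun γ s => completionSMul_eta (G := G) (S := (E.proj ⁻¹' {x₀})) γ s
    have key := (ProfiniteGrp.ProfiniteCompletion.denseRange (G := GrpCat.of G)).equalizer h₁ h₂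
      (funext fun γ => by
        change μ E (completionSMul (θhat.hom (toCompletion G γ)) y) =
          completionSMul (toCompletion G γ) (μ E y)
        rw [hθhat, heta, heta]
        exact hμeq E hE γ y)
    exact congrFun key g
  have hηeq : ∀ (U : P.FullSubcategory) (g : profiniteCompletion G) (x : U.obj.obj.V),
      η U (θhat.hom g • x) = g • η U x := by
    intro U g x
    change (c U.obj).hom (μ _ ((c' U.obj).hom ((U.obj.obj.ρ (θhat.hom g)).hom x))) =
      (U.obj.obj.ρ g).hom ((c U.obj).hom (μ _ ((c' U.obj).hom x)))
    rw [hc'eq, hμhat _ U.property, ← hceq]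
  -- naturality
  have hηnat : ∀ {U V : P.FullSubcategory} (k : U ⟶ V) (x : U.obj.obj.V),
      η V (k.hom.hom.hom x) = k.hom.hom.hom (η U x) := by
    intro U V k x
    -- naturality of the counit: `e.functor.map (e.inverse.map k) ≫ ε_V = ε_U ≫ k`
    have hnat := e.counitIso.hom.naturality k.hom
    have hnat' : ∀ y, (c V.obj).hom ((e.functor.map (e.inverse.map k.hom)).hom.hom y) =
        k.hom.hom.hom ((c U.obj).hom y) := fun y => by
      have h := congrArg (fun t => t.hom.hom.hom y) hnat
      exact h
    -- hence also for the inverses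
    have hnat'' : ∀ x, (c' V.obj).hom (k.hom.hom.hom x) =
        (e.functor.map (e.inverse.map k.hom)).hom.hom ((c' U.obj).hom x) := fun x => by
      have h := hnat' ((c' U.obj).hom x)
      rw [hcc'] at h
      have := congrArg (fun z => (c' V.obj).hom z) h
      rw [hc'c] at this
      exact this.symm
    change (c V.obj).hom (μ _ ((c' V.obj).hom (k.hom.hom.hom x))) =
      k.hom.hom.hom ((c U.obj).hom (μ _ ((c' U.obj).hom x)))
    rw [hnat'', ← hnat']
    congr 1
    exact hμnat U.property V.property (e.inverse.map k.hom) _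
  -- abc-iut-L6-t18: a twisted natural family forces the twist to be inner
  obtain ⟨n, hn⟩ := exists_eq_conj_of_twisted_natural (G := profiniteCompletion G) θhat.hom.toMonoidHom
    P hP η hηeq hηnat
  refine ⟨n, fun γ => ?_⟩
  rw [← hθhat]
  exact hn (toCompletion G γ)

/-! ### From self-maps of the covers lying over a homeomorphism `σ` of the base to twisted families
of fibre maps -/

omit [PathConnectedSpace X] [StronglyLocallyContractibleSpace X] in
/-- **Lifts through a map of covers over `σ`.**  If `b : E → E` is continuous and lies over a
continuous self-map `σ` of `X` (`p ∘ b = σ ∘ p`), then `b` carries the monodromy of `E` along a path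
class `λ` to the monodromy along `σ ∘ λ`: `(σ_* λ) · b(e) = b (λ · e)` (uniqueness of lifts).
[cite: HatcherAT2002, §1.3 Prop. 1.34] -/
theorem monodromy_map_of_over (E : CovFin X) (σ : C(X, X)) (b : E.obj.left → E.obj.left)
    (hbc : Continuous b) (hb : ∀ y, E.proj (b y) = σ (E.proj y)) {x x' : X}
    (γ : Path.Homotopic.Quotient x x') (e : E.proj ⁻¹' {x}) :
    E.isCoveringMap_proj.monodromy (γ.map σ)
        ⟨b e, (hb e).trans (congrArg σ e.2)⟩ =
      ⟨b (E.isCoveringMap_proj.monodromy γ e),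
        (hb _).trans (congrArg σ (E.isCoveringMap_proj.monodromy γ e).2)⟩ := by
  obtain ⟨γ₀, rfl⟩ := Path.Homotopic.Quotient.mk_surjective γ
  have he : γ₀ 0 = E.proj e := γ₀.source.trans e.2.symm
  have hbe : (γ₀.map σ.continuous) 0 = E.proj (b e) := by
    rw [hb e]; exact congrArg σ he
  apply Subtype.ext
  change E.isCoveringMap_proj.liftPath (γ₀.map σ.continuous) (b e) hbe 1 =
    b (E.isCoveringMap_proj.liftPath γ₀ e he 1)
  have key : (⟨fun t => b (E.isCoveringMap_proj.liftPath γ₀ e he t),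
        hbc.comp (E.isCoveringMap_proj.liftPath γ₀ e he).continuous⟩ : C(unitInterval, E.obj.left)) =
      E.isCoveringMap_proj.liftPath (γ₀.map σ.continuous) (b e) hbe := by
    refine (E.isCoveringMap_proj.eq_liftPath_iff' hbe).mpr ⟨?_, ?_⟩
    · funext t
      simp only [Function.comp_apply, ContinuousMap.coe_mk, hb]
      exact congrArg σ (congrFun (E.isCoveringMap_proj.liftPath_lifts γ₀ e he) t)
    · simp only [ContinuousMap.coe_mk, E.isCoveringMap_proj.liftPath_zero]
  exact (congrFun (congrArg DFunLike.coe key) 1).symm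

omit [PathConnectedSpace X] [StronglyLocallyContractibleSpace X] in
/-- The endomorphism `θ_{σ,δ} := (σ_*)⁻¹ ∘ (δ-conjugation)` of `π₁(X, x₀)` attached to a homeomorphism
`σ` and a path `δ` from `x₀` to `σ x₀` satisfies `σ_* (θ γ) = δ⁻¹ · γ · δ` as path classes at `σ x₀`.
[cite: HatcherAT2002, §1.1 Prop. 1.5] -/
theorem map_twist_eq (σ : X ≃ₜ X) (δ : Path x₀ (σ x₀)) (γ : FundamentalGroup X x₀) :
    Path.Homotopic.Quotient.map
        (FundamentalGroup.toPath
          (((FundamentalGroup.fundamentalGroupMulEquivOfPath δ).trans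
            (σ.fundamentalGroupMulEquiv rfl).symm) γ))
        ⟨σ, σ.continuous⟩ =
      (Path.Homotopic.Quotient.mk δ).symm.trans
        ((FundamentalGroup.toPath γ).trans (Path.Homotopic.Quotient.mk δ)) := by
  set lam := FundamentalGroup.fundamentalGroupMulEquivOfPath δ γ with hlam
  have h1 : (σ.fundamentalGroupMulEquiv rfl) ((σ.fundamentalGroupMulEquiv rfl).symm lam) = lam :=
    MulEquiv.apply_symm_apply _ _
  have h2 : ∀ ν : FundamentalGroup X x₀,
      FundamentalGroup.toPath ((σ.fundamentalGroupMulEquiv (rfl : σ x₀ = σ x₀)) ν) =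
        Path.Homotopic.Quotient.map (FundamentalGroup.toPath ν) ⟨σ, σ.continuous⟩ := by
    intro ν
    change FundamentalGroup.toPath (FundamentalGroup.mapOfEq (⟨σ, σ.continuous⟩ : C(X, X)) rfl ν) = _
    rw [FundamentalGroup.mapOfEq_apply]
    exact Path.Homotopic.Quotient.cast_rfl_rfl _
  rw [MulEquiv.trans_apply, ← h2, h1, hlam]
  rfl

/-- **A `σ`-twisted natural family of self-maps of the connected finite covers forces the twist to
be profinitely inner** (general form: `σ` any continuous self-map of `X`, `δ` a path from `x₀` to
`σ x₀`, `θ` any endomorphism of `π₁(X, x₀)` with `σ_* (θ γ) = δ⁻¹ · γ · δ`).  If every CONNECTED finite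
covering space `E → X` carries a continuous self-map `b_E` lying over `σ` (`p_E ∘ b_E = σ ∘ p_E`),
naturally in `E` (the `b_E` commute with all maps of covers between connected finite covers), then
`ι(θ γ) = n⁻¹ ι(γ) n` for some `n ∈ π̂₁(X, x₀)` and all `γ` (the fibre maps `e ↦ δ⁻¹ · b_E(e)` form a
`θ`-twisted natural family; `exists_eq_conj_of_twisted_fibre_family`).
[cite: MochizukiSemiAnbd2006, Section 0 p.6] [cite: MochizukiAbsTopIII2015, Proposition 4.2 (i) p.106] -/
theorem exists_eq_conj_of_twisted_cover_family_of_map (σ : C(X, X)) (δ : Path x₀ (σ x₀))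
    (θ : FundamentalGroup X x₀ →* FundamentalGroup X x₀)
    (hθ : ∀ γ : FundamentalGroup X x₀,
      Path.Homotopic.Quotient.map (FundamentalGroup.toPath (θ γ)) σ =
        (Path.Homotopic.Quotient.mk δ).symm.trans
          ((FundamentalGroup.toPath γ).trans (Path.Homotopic.Quotient.mk δ)))
    (b : ∀ E : CovFin X, E.obj.left → E.obj.left)
    (hbc : ∀ E : CovFin X, ConnectedSpace E.obj.left → Continuous (b E))
    (hb : ∀ E : CovFin X, ConnectedSpace E.obj.left → ∀ y, E.proj (b E y) = σ (E.proj y))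
    (hbnat : ∀ {E E' : CovFin X}, ConnectedSpace E.obj.left → ConnectedSpace E'.obj.left →
      ∀ (k : E ⟶ E') (y : E.obj.left), b E' (k.hom.left y) = k.hom.left (b E y)) :
    ∃ n : profiniteCompletion (FundamentalGroup X x₀),
      ∀ γ : FundamentalGroup X x₀, toCompletion _ (θ γ) = n⁻¹ * toCompletion _ γ * n := by
  classical
  let δ' : Path.Homotopic.Quotient (σ x₀) x₀ := (Path.Homotopic.Quotient.mk δ).symm
  -- the family of fibre maps `e ↦ δ⁻¹ · b_E(e)` (junk on disconnected covers)
  let μ : ∀ E : CovFin X, (E.proj ⁻¹' {x₀}) → (E.proj ⁻¹' {x₀}) := fun E e =>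
    if hE : ConnectedSpace E.obj.left then
      E.isCoveringMap_proj.monodromy δ' ⟨b E e, (hb E hE e).trans (congrArg σ e.2)⟩
    else e
  have hμ : ∀ (E : CovFin X) (hE : ConnectedSpace E.obj.left) (e : E.proj ⁻¹' {x₀}),
      μ E e = E.isCoveringMap_proj.monodromy δ' ⟨b E e, (hb E hE e).trans (congrArg σ e.2)⟩ :=
    fun E hE e => dif_pos hE
  refine exists_eq_conj_of_twisted_fibre_family x₀ θ μ ?_ ?_
  · -- twisted equivariance
    intro E hE γ e
    rw [hμ E hE, hμ E hE, ← E.isCoveringMap_proj.monodromy_trans_apply]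
    have hlift := monodromy_map_of_over E σ (b E) (hbc E hE) (hb E hE)
      (FundamentalGroup.toPath (θ γ)) e
    change E.isCoveringMap_proj.monodromy δ' ⟨b E (E.isCoveringMap_proj.monodromy (θ γ) e), _⟩ = _
    rw [← hlift, ← E.isCoveringMap_proj.monodromy_trans_apply]
    congr 1
    rw [hθ γ]
    change (δ'.trans ((FundamentalGroup.toPath γ).trans (Path.Homotopic.Quotient.mk δ))).trans δ' =
      δ'.trans (FundamentalGroup.toPath γ)
    rw [Path.Homotopic.Quotient.trans_assoc, Path.Homotopic.Quotient.trans_assoc]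
    change δ'.trans ((FundamentalGroup.toPath γ).trans
      ((Path.Homotopic.Quotient.mk δ).trans (Path.Homotopic.Quotient.mk δ).symm)) = _
    rw [Path.Homotopic.Quotient.trans_symm, Path.Homotopic.Quotient.trans_refl]
  · -- naturality
    intro E E' hE hE' k e
    rw [hμ E hE, hμ E' hE', fibreFunctor_map_apply, fibreFunctor_map_apply,
      ← CoverMorphism.monodromy_fibreMap E.isCoveringMap_proj E'.isCoveringMap_proj (continuous_hom k)
        (hom_over k)]
    congr 1
    ext
    exact hbnat hE hE' k e

/-- **A `σ`-twisted natural family of self-maps of the connected finite covers, `σ` a homeomorphism,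
forces `(σ_*)⁻¹ ∘ Ad(δ)` to be profinitely inner**: with `δ` a path from `x₀` to `σ x₀`, the
automorphism `θ = (σ_*)⁻¹ ∘ Ad(δ)` of `π₁(X, x₀)` satisfies `ι(θ γ) = n⁻¹ ι(γ) n` for some
`n ∈ π̂₁(X, x₀)` and all `γ`.  So if `σ_*` is NOT inner on `π̂₁(X, x₀)` (as an outer class), no natural
family of lifts of `σ` to the connected finite covers exists — the honest per-object criterion of
[AbsTopIII] Prop. 4.2 (i) («`Aut(X) → Out(π̂₁)`»).
[cite: MochizukiSemiAnbd2006, Section 0 p.6] [cite: MochizukiAbsTopIII2015, Proposition 4.2 (i) p.106] -/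
theorem exists_eq_conj_of_twisted_cover_family (σ : X ≃ₜ X) (δ : Path x₀ (σ x₀))
    (b : ∀ E : CovFin X, E.obj.left → E.obj.left)
    (hbc : ∀ E : CovFin X, ConnectedSpace E.obj.left → Continuous (b E))
    (hb : ∀ E : CovFin X, ConnectedSpace E.obj.left → ∀ y, E.proj (b E y) = σ (E.proj y))
    (hbnat : ∀ {E E' : CovFin X}, ConnectedSpace E.obj.left → ConnectedSpace E'.obj.left →
      ∀ (k : E ⟶ E') (y : E.obj.left), b E' (k.hom.left y) = k.hom.left (b E y)) :
    ∃ n : profiniteCompletion (FundamentalGroup X x₀),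
      ∀ γ : FundamentalGroup X x₀,
        toCompletion _ (((FundamentalGroup.fundamentalGroupMulEquivOfPath δ).trans
          (σ.fundamentalGroupMulEquiv rfl).symm) γ) = n⁻¹ * toCompletion _ γ * n :=
  exists_eq_conj_of_twisted_cover_family_of_map x₀ ⟨σ, σ.continuous⟩ δ
    ((FundamentalGroup.fundamentalGroupMulEquivOfPath δ).trans
      (σ.fundamentalGroupMulEquiv rfl).symm).toMonoidHom
    (fun γ => map_twist_eq x₀ σ δ γ) b hbc hb hbnat

end Literature.Topology.CoveringSpaces.CovFin
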